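import Literature.NumberTheory.EllipticCurves.LevelLoweringGamma0AtThree
import Literature.NumberTheory.EllipticCurves.CuspFormLFunction
import Literature.NumberTheory.EllipticCurves.GlobalMinimalModel
import HarnessLib

/-!
# Level lowering at a squarefree set of unramified (resp. finite) multiplicative primes, in `Γ₀(N(ρ̄)·p^δ)`-newform
# currency, for `p ≥ 5`, conductor WITH ADDITIVE PRIMES (Ribet 1990 / Darmon–Diamond–Taylor Thm. 3.15 + Lemma 2.7 + Prop. 2.12 + Thm. 3.1)

Topic `NumberTheory/EllipticCurves`; namespace `Literature.NumberTheory.EllipticCurves`. ONE named fact (`def … : Prop`, nothing asserted,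
nothing admitted) + its `Iff.rfl` unfolding lemma. The `p ≥ 5` SIBLING of the tree's `p = 3` facts in `Γ₀`-newform currency —
`ribet1990_levelLowering_gamma0_newform_at_three` (ONE unramified multiplicative prime, semistable; module `LevelLoweringGamma0AtThree`),
`…_squarefree`, and `ribet1990_levelLowering_gamma0_newform_at_three_general` (ANY squarefree set of removed primes, additive primes allowed;
module `LevelLoweringGamma0AtThreeGeneralLevel`, whose «`-- TODO(general form): every p ≥ 5`» this file discharges at the OPTIMAL level). Typed by
the LEAD seat `cruxlead-stmt-BirchSwinnertonDyer-20614` (cell `bsd-print-x11a`, crux U5 `Summit.…Theses.PrintX11a.UpperNonSurjFive`, line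
«gl1cartan5», EXCEPTIONAL-ZERO road): its consumer is `Summit.…Theorems.GL1Cartan.Exc.one_le_padicValRat_LOne_div_of_classX11a_split` (file
`Summits/BirchSwinnertonDyer/BirchSwinnertonDyer/Theorems/PrintX11aUpperNonSurjFiveExcShallowSector.lean`), where the removed set `R` is «every
multiplicative prime `≠ p`» (all unramified on class X11a) together with `p` itself (finite at a non-surjective `p`), and the conclusion feeds the
`p`-stabilisation / Vatsal-congruence / Ihara assembly of `…Theorems.PrintX11aUpperNonSurjFiveExcDivisibility`.

## What is packaged, and why every clause is in print

For an elliptic curve `E/ℚ` (globally minimal model `W₀`, conductor `N = M₀·R` with `p² ∤ N`, `R` squarefree and prime to `M₀`), a prime `p ≥ 5`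
with `ρ̄ = ρ̄_{E,p} : G_ℚ → GL₂(𝔽_p)` IRREDUCIBLE — hence absolutely irreducible, `p` being odd («if `ℓ` is odd, one checks … that `ρ̄` is irreducible
if and only if it is absolutely irreducible» [cite: DarmonDiamondTaylor1995, p. 87]) —, such that every prime `r ∣ R` is multiplicative with
`p ∣ ord_r(Δ_min)` and every multiplicative prime `q ∤ R` has `p ∤ ord_q(Δ_min)`:

1. (Multiplicative primes, Tate curve.) `ρ̄|_{G_r} ≅ (χ̄_p Ψ, 1) ⊗ δ` with `Ψ` the Kummer class of the Tate period [cite: DarmonDiamondTaylor1995, Prop. 2.12 (a)–(b)];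
   for `r ≠ p`, `ρ̄` is unramified at `r` iff `p ∣ ord_r(Δ_min)` [cite: DarmonDiamondTaylor1995, Prop. 2.12 (c)]; for `r = p`, `ρ̄|_{G_p}` is «good»
   (finite flat) iff `p ∣ ord_p(Δ_min)` [cite: DarmonDiamondTaylor1995, Prop. 2.12 (d), Lemma 2.22 (c)], and it is ordinary in any case (Prop. 2.23).
   Hence the exponent of `N(ρ̄)` at a multiplicative `q ≠ p` is `0` if `q ∣ R` and `1` if `q ∤ R` (ramified, conductor exponent `1` as for `E`,
   §2.1 p. 54), and the invariant `δ(ρ̄)` (definition preceding Thm. 3.15, p. 90) is `0` if `p` is good or `p ∣ R` (finite), and `1` if `p` is a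
   multiplicative prime `∤ R` (`ρ̄|_{I_p} = (χ̄_p, *; 0, 1)`, not good: the case `a = 1 < p`).
2. (Additive primes — the clause in which `p ≥ 5` differs from the `p = 3` sibling.) Let `q² ∣ N`, so `q ≠ p`. Serre's exponent at `q` is
   `m_q(ρ̄) = f_q(E) − dim E[p]^{I_q}` (Darmon–Diamond–Taylor Lemma 2.7: `N(ρ) = N(ρ̄)·∏_{q ≠ p} q^{dim ρ̄^{I_q} − dim ρ^{I_q}}`, with Remark 2.14: the
   conductor of `ρ_{E,p}|_{G_q}` is `f_q(E)`, and `V_pE^{I_q} = 0` at an additive `q`) [cite: DarmonDiamondTaylor1995, Lemma 2.7 and Remark 2.14].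
   And `E[p]^{I_q} = E(ℚ_q^{nr})[p] = 0`: by Kodaira–Néron `[E(ℚ_q^{nr}) : E₀(ℚ_q^{nr})] = #Φ_q(𝔽̄_q) ≤ 4 < p` at an additive place (types
   `II, III, IV, I_n^*, IV^*, III^*, II^*` have component groups of order `1, 2, 3, 4, 3, 2, 1`), and `E₀(ℚ_q^{nr})` has no `p`-torsion at an additive
   `q ≠ p` (formal group pro-`q`, `Ẽ_ns(𝔽̄_q) = 𝔾_a`) [cite: SilvermanATAEC1994, Cor. IV.9.2 (d) with Table 4.1] — in the tree this is the theorem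
   `Summit.BirchSwinnertonDyer.Rank1Residual.GaloisImage.InertiaDivisible.localPoints_eq_zero_of_absInertia_fixed_of_not_dvd_componentGroupOrder`.
   So `m_q(ρ̄) = f_q(E)`: NO additive exponent drops, and with 1. the optimal level is `N(ρ̄)·p^{δ(ρ̄)} = N/R = M₀` EXACTLY. (At `p = 3` the types
   `IV, IV^*` — `#Φ = 3` — can drop, whence the sibling's clause «`3 ∤ #Φ_v`»; at `p ≥ 5` that clause is void.)
3. THEOREM 3.15 of Darmon–Diamond–Taylor (`ℓ = p` odd; for `ℓ ≥ 5` no further proviso; `ρ̄` absolutely irreducible and modular, from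
   `f_E ∈ S₂(Γ₀(N))`) [cite: DarmonDiamondTaylor1995, Thm. 3.15 (pp. 90–91)] (packaging RIBET's theorem [cite: Ribet1990, Thm. 1.1] with Carayol's
   lemma, Mazur's principle and Edixhoven's weight optimisation [cite: Diamond1995RefinedSerre, Thm. 1.1]): there is a weight-two NEWFORM `g` with
   `ρ̄ ≅ ρ̄_g`, level `N_g = N(ρ̄)·p^{δ(ρ̄)} = M₀`, and character `ψ_g` of order prime to `p` — hence trivial: its reduction is `det ρ̄·χ̄_p⁻¹ = 1`
   (Thm. 3.1 (b)) and prime-to-`p` roots of unity inject modulo `p`. So `g ∈ S₂(Γ₀(M₀))`.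
4. The congruences, modulo the prime of `ℚ̄ ⊂ ℂ` over `p` singled out by `ι` (replace `g` by a `Gal(ℚ̄/ℚ)`-conjugate): at `ℓ ∤ Np` both `a_ℓ` are
   `tr ρ̄(Frob_ℓ)` [cite: DarmonDiamondTaylor1995, Thm. 3.1 (a)]; at a REMOVED `r ≠ p`: `a_r(g) = tr ρ̄_g(Frob_r) ≡ tr ρ̄_E(Frob_r) = a_r(E)(r + 1)`
   (unramified Tate curve, 1.); at the REMOVED `r = p`: `ρ_g|_{G_p}` is good (`p ∤ N_g`, Thm. 3.1 (f)) with ordinary reduction `ρ̄_E|_{G_p}`, hence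
   ordinary [cite: DarmonDiamondTaylor1995, Lemma 2.25 (b)], with unramified quotient `Frob_p ↦` the unit root of `X² − a_p(g)X + p`, `≡ a_p(g)`
   [cite: DarmonDiamondTaylor1995, Thm. 3.1 (f)] (Deligne's theorem [cite: Edixhoven1992, Thm. 2.5]); the unramified rank-one quotient of
   `ρ̄_E|_{G_p} = (χ̄_pΨ, *; 0, 1) ⊗ δ` is `δ`, `Frob_p ↦ a_p(E) = ±1`, and it is the ONLY one (`χ̄_p|_{I_p} ≠ 1`); so `a_p(g) ≡ a_p(E) ≡ a_p(E)(p + 1)`;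
   at a KEPT multiplicative `q` (`q ∥ N_g`): `a_q(g) = ±1` is the Frobenius value on the unramified quotient line of `ρ_g|_{G_q}`
   [cite: DarmonDiamondTaylor1995, Thm. 3.1 (e)] (resp. `a_p(g)` on `ρ_{g,I_p}` by Thm. 3.1 (g) when `q = p`), which reduces to the UNIQUE unramified
   quotient line of the ramified (resp. `χ̄_p`-twisted) `ρ̄|_{G_q}`, where `E` has the value `a_q(E)` (1.) [cite: Carayol1986, Thm. (A)]; at an
   ADDITIVE `q` (`q² ∣ M₀ = N_g`) BOTH coefficients vanish: `a_q(E) = 0` and `a_q(g) = 0` for a newform on `Γ₀(N_g)` with `q² ∣ N_g`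
   [cite: AtkinLehner1970, Thm. 3] (tree theorem `Literature.NumberTheory.EllipticCurves.ModularForms.IsNewform0.cuspCoeff_eq_zero_of_sq_dvd`). Hence
   «`a_q(g) ≡ a_q(f_E)` for every prime `q ∤ R`» and «`a_r(g) ≡ a_r(f_E)(r + 1)` for every prime `r ∣ R`».

PRINT vs. CONSUMER: nothing requested is dropped; the split/non-split type of the primes of `R` is NOT assumed; whether `p ∈ R` is not assumed.
The hypothesis-free form «a newform of level exactly `N/R`» is NOT a printed theorem when `ρ̄` is unramified at a multiplicative prime outside
`R` or not finite at `p ∈ R` (non-optimal levels: Diamond–Taylor 1994) — excluded by the two `ord(Δ_min)` clauses, which force `M₀ = N(ρ̄)·p^δ`.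
Irreducibility replaces the sibling's surjectivity (at `p = 3` surjectivity also served Thm. 3.15's proviso «`ρ̄|_{G_{ℚ(√−3)}}` absolutely
irreducible», absent for `p ≥ 5`). PRESEARCH (2026-08-29; corpus fts + vec + galaxy, citation graph): Darmon–Diamond–Taylor 1995 HELD
(`paper:doi-10-4310-cdm-1995-v1995-n1-a1`, pp. 54–58, 63–65, 85–87, 90–91 read first-hand); Ribet–Stein, *Lectures on Serre's conjectures* HELD
(Thm. 3.11, 3.14: context); Diamond–Taylor 1994 and Kraus 1997 NOT held and not needed for this optimal-level form; tree: the `p = 3` siblings above,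
`diamond1995_refinedSerre` (`Γ₁(N(ρ̄))`/Serre-weight currency, congruences off `pN(ρ̄)` only), `carayolLivne_additivePrime_dvd_level_of_congruent_newform`
(the converse bound at additive primes) — this file restates none of them.
-- TODO(general form): the additive-at-`p` case (`p² ∣ N`: Serre weight and Kraus's table), and non-optimal levels (Diamond–Taylor 1994, Thm. A).

## References

* H. Darmon, F. Diamond, R. Taylor, *Fermat's Last Theorem*, Current Developments in Mathematics 1995, International Press, 1–154: §2.1 (p. 54),
  Lemma 2.7, Prop. 2.12, Remark 2.14, Lemma 2.22 (c), Prop. 2.23, Lemma 2.25 (b), Thm. 3.1 (a)(b)(e)(f)(g) (pp. 85–86), p. 87, Thm. 3.15 (pp. 90–91).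
  [DarmonDiamondTaylor1995]
* K. A. Ribet, *On modular representations of Gal(ℚ̄/ℚ) arising from modular forms*, Invent. Math. 100 (1990) 431–476, Thm. 1.1. [Ribet1990]
* F. Diamond, *The refined conjecture of Serre* (1995), Thm. 1.1, Cor. 1.2. [Diamond1995RefinedSerre]
* B. Edixhoven, *The weight in Serre's conjectures on modular forms*, Invent. Math. 109 (1992), Thms. 2.5–2.6. [Edixhoven1992]
* H. Carayol, Ann. Sci. ÉNS 19 (1986) 409–468, Thm. (A). [Carayol1986]
* A. O. L. Atkin, J. Lehner, *Hecke operators on `Γ₀(m)`*, Math. Ann. 185 (1970), Thm. 3. [AtkinLehner1970]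
* J. H. Silverman, *Advanced Topics in the Arithmetic of Elliptic Curves*, GTM 151 (1994), §IV.9 Cor. 9.2 (d), Table 4.1, §IV.10. [SilvermanATAEC1994]
-/

noncomputable section

open scoped MatrixGroups ModularForm

open CongruenceSubgroup WeierstrassCurve Literature.NumberTheory.EllipticCurves.ModularForms

namespace Literature.NumberTheory.EllipticCurves

/-- **Level lowering at a squarefree set of unramified (resp. finite) multiplicative primes, in `Γ₀(N(ρ̄)·p^δ)`-newform currency, `p ≥ 5`,
conductor with additive primes** (Ribet 1990, Thm. 1.1, in the weight-two packaging of Darmon–Diamond–Taylor 1995, Thm. 3.15 — `ℓ = p ≥ 5`, character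
of order prime to `p` hence trivial —, with their Lemma 2.7 / Remark 2.14 for the exponent of `N(ρ̄)` at the additive primes (no drop for `p ≥ 5`:
`#Φ_q(𝔽̄_q) ≤ 4 < p`, Kodaira–Néron), Prop. 2.12 for the Tate curve at the multiplicative primes, Thm. 3.1 (a)(e)(f)(g) with Prop. 2.23 / Lemma 2.25 (b)
for the local congruences, and Atkin–Lehner's `a_q = 0` at `q² ∣ N_g`; see the module docstring for the clause-by-clause derivation). For a globally
minimal `W₀/ℚ`, elliptic, a prime `p ≥ 5` with `W₀[p]` IRREDUCIBLE, conductor `N = M₀·R` with `p² ∤ N`, `R` squarefree and prime to `M₀`, such that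
every prime `r ∣ R` is multiplicative with `p ∣ ord_r(Δ_min)` (`ρ̄` unramified at `r ≠ p`, finite at `r = p`) and every multiplicative prime `q ∤ R` has
`p ∤ ord_q(Δ_min)` (so that `M₀ = N(ρ̄)·p^{δ(ρ̄)}` is the optimal level): for every newform `f` of `W₀` at level `N` (`IsNewformOf W₀ f`, i.e. `f = f_E`)
and every field isomorphism `ι : ℚ̄_p ≃+* ℂ` there is a NEWFORM `g ∈ S₂(Γ₀(M₀))` with `a_q(g) ≡ a_q(f)` for every prime `q ∤ R` and
`a_r(g) ≡ a_r(f)(r + 1)` for every prime `r ∣ R`, the congruences being modulo the maximal ideal of `𝒪_{ℚ̄_p}` after transport by `ι⁻¹`.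
[cite: DarmonDiamondTaylor1995, Thm. 3.15 (pp. 90–91), Lemma 2.7, Remark 2.14, Prop. 2.12, Prop. 2.23, Lemma 2.25 (b), Thm. 3.1 (a)(e)(f)(g) (pp. 85–86), p. 87]
[cite: Ribet1990, Thm. 1.1] [cite: Diamond1995RefinedSerre, Thm. 1.1] [cite: Edixhoven1992, Thm. 2.5]
[cite: SilvermanATAEC1994, Cor. IV.9.2 (d) with Table 4.1] [cite: Carayol1986, Thm. (A)] [cite: AtkinLehner1970, Thm. 3] -/
def ribet1990_levelLowering_gamma0_newform_general_of_five_le : Prop :=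
  ∀ (W₀ : WeierstrassCurve ℚ) [W₀.IsElliptic] [W₀.IsGloballyMinimal] (p : ℕ) [Fact p.Prime], 5 ≤ p →
    W₀.HasIrreducibleModPGaloisRep p →
    ∀ {N M₀ R : ℕ} [NeZero N] [NeZero M₀], M₀ * R = N → Squarefree R → Nat.Coprime R M₀ → ¬ p ^ 2 ∣ N →
      N = W₀.conductorNorm ℤ →
      (∀ (r : ℕ) (hr : r.Prime), r ∣ R →
        (haveI : Fact r.Prime := ⟨hr⟩; W₀.HasMultiplicativeReductionAtPrime r) ∧ p ∣ padicValInt r W₀.minimalDiscriminantInt) →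
      (∀ (q : ℕ) (hq : q.Prime), (haveI : Fact q.Prime := ⟨hq⟩; W₀.HasMultiplicativeReductionAtPrime q) → ¬ q ∣ R →
        ¬ p ∣ padicValInt q W₀.minimalDiscriminantInt) →
      ∀ (f : CuspForm (Gamma0 N) 2), IsNewformOf W₀ f → ∀ (ι : PadicAlgCl p ≃+* ℂ),
        ∃ g : CuspForm (Gamma0 M₀) 2, IsNewform0 g ∧
          (∀ q : ℕ, q.Prime → ¬ q ∣ R → Valued.v (ι.symm (cuspCoeff f q - cuspCoeff g q)) < 1) ∧
          (∀ r : ℕ, r.Prime → r ∣ R → Valued.v (ι.symm (cuspCoeff g r - cuspCoeff f r * (r + 1))) < 1)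

/-- Unfolding lemma (the fact is a `Prop`-valued definition; this is its statement).
[cite: DarmonDiamondTaylor1995, Thm. 3.15 and Lemma 2.7] [cite: Ribet1990, Thm. 1.1] -/
theorem ribet1990_levelLowering_gamma0_newform_general_of_five_le_iff :
    ribet1990_levelLowering_gamma0_newform_general_of_five_le ↔
      ∀ (W₀ : WeierstrassCurve ℚ) [W₀.IsElliptic] [W₀.IsGloballyMinimal] (p : ℕ) [Fact p.Prime], 5 ≤ p →
        W₀.HasIrreducibleModPGaloisRep p →
        ∀ {N M₀ R : ℕ} [NeZero N] [NeZero M₀], M₀ * R = N → Squarefree R → Nat.Coprime R M₀ → ¬ p ^ 2 ∣ N →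
          N = W₀.conductorNorm ℤ →
          (∀ (r : ℕ) (hr : r.Prime), r ∣ R →
            (haveI : Fact r.Prime := ⟨hr⟩; W₀.HasMultiplicativeReductionAtPrime r) ∧ p ∣ padicValInt r W₀.minimalDiscriminantInt) →
          (∀ (q : ℕ) (hq : q.Prime), (haveI : Fact q.Prime := ⟨hq⟩; W₀.HasMultiplicativeReductionAtPrime q) → ¬ q ∣ R →
            ¬ p ∣ padicValInt q W₀.minimalDiscriminantInt) →
          ∀ (f : CuspForm (Gamma0 N) 2), IsNewformOf W₀ f → ∀ (ι : PadicAlgCl p ≃+* ℂ),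
            ∃ g : CuspForm (Gamma0 M₀) 2, IsNewform0 g ∧
              (∀ q : ℕ, q.Prime → ¬ q ∣ R → Valued.v (ι.symm (cuspCoeff f q - cuspCoeff g q)) < 1) ∧
              (∀ r : ℕ, r.Prime → r ∣ R → Valued.v (ι.symm (cuspCoeff g r - cuspCoeff f r * (r + 1))) < 1) :=
  Iff.rfl

end Literature.NumberTheory.EllipticCurves

end
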